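import Literature.MathematicalPhysics.KineticTheory.LambertianHardSphereFlow
import Literature.Analysis.FluidPDE.HardSphereTorusMeasure
import Literature.Analysis.FluidPDE.HardSphereFlowOrbits
import Literature.MathematicalPhysics.KineticTheory.HardSphereEuler
import HarnessLib

/-!
# First-collision inclusion for the Lambertian hard-sphere gas (crux `LambertianEuler`, stmt-AtomisticToContinuum-11854, line `Sketch`, stub `measure_lambertCount_pos_le`)

Support file (`--supports stmt-AtomisticToContinuum-11854`).  Registered sub-goal
`measure_lambertCount_pos_le` (E3 of lead c9, wave 3: an input of the `N`-uniform equilibrium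
collision rate of the Lambertian gas).  For `0 < σ < 1/2`, `N`, a finite law `P` on the torus phase
space absolutely continuous with respect to the Liouville measure of `N + 1` spheres of diameter
`ε = hsDiameter σ N`, and `δ ≥ 0`:

`(P ⊗ γ^ℕ) {p | 1 ≤ K_δ p} ≤ Σ_i Σ_j P {z | i ≠ j ∧ ε ≤ ‖sep(x_i, x_j)‖ ≤ ε + δ ‖v_i − v_j‖}`,

where `K_δ (z, ξs) = lambertCount G ε ξs z δ` is the number of Lambertian collisions in `[0, δ]`
and `γ^ℕ = lambertNoise (Fin 3)`.

## Proof

* The event does not depend on the noise: `1 ≤ K_δ (z, ξs)` forces `τ(z) = freeExitTime G ε z ≤ δ`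
  (contrapositive of `lambertCount_eq_zero_of_lt`), so the event is contained in
  `{τ ≤ δ} ×ˢ univ`, of `P ⊗ γ^ℕ`-measure at most `P {τ ≤ δ}` (`Measure.prod_prod_le`).
* `P`-almost every `z` lies in the hard-sphere domain `D` (`P ≪ liouville = volume|_D`).
* Pointwise (`exists_pair_of_freeExitTime_le`): if `z ∈ D` and `τ(z) ≤ δ` then some pair `i ≠ j`
  starts at minimal-image distance in `[ε, ε + δ ‖v_i − v_j‖]`.  Indeed, otherwise every pair has
  `‖sep(x_i, x_j)‖ > ε + δ ‖v_i − v_j‖`, hence (finitely many pairs) `> ε + (δ + η) ‖v_i − v_j‖` for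
  some `η > 0`; since the minimal-image distance is `1`-Lipschitz under translations
  (`Torus.euclidDist_le_euclidDist_translate`), along the free flight
  `‖sep((S_t z)_i, (S_t z)_j)‖ ≥ ‖sep(x_i, x_j)‖ − t ‖v_i − v_j‖ ≥ ε` for `0 ≤ t < δ + η`, so the free
  flight stays in `D` and `τ(z) ≥ δ + η > δ` (`le_freeExitTime_of_forall_mem`), a contradiction.
* Finite subadditivity over the pairs (`measure_iUnion_fintype_le`).

References: C. Cercignani, R. Illner, M. Pulvirenti, *The Mathematical Theory of Dilute Gases* (1994),
App. 4.A (the collision-by-collision construction; the first collision time is the exit time of the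
free flight).  All statements here [folklore].
-/

noncomputable section

namespace Summit.AtomisticToContinuum.HydrodynamicLimit.Theorems.LambertianContactSwapLambertianEulerFirstCollision

open scoped BigOperators Topology ENNReal
open MeasureTheory ProbabilityTheory Filter Set
open Literature.MathematicalPhysics.KineticTheory
open Literature.Analysis.FluidPDE Literature.Analysis.FluidPDE.Alexander

/-! ## Free flight on the torus moves pairs apart at most linearly -/

/-- Along the free flight on the flat torus the minimal-image separation of a pair decreases at most
linearly: `‖sep(x_i, x_j)‖ ≤ ‖sep((S_t z)_i, (S_t z)_j)‖ + |t| ‖v_i − v_j‖` (the minimal-image distance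
is `1`-Lipschitz under translations). [folklore] -/
theorem norm_sepVec_le_norm_sepVec_freeFlight_add {d : Type*} [Fintype d] {N : ℕ}
    (z : Config N d (UnitAddTorus d)) (t : ℝ) (i j : Fin N) :
    ‖(Torus.geometry d).sepVec (z i).1 (z j).1‖ ≤
      ‖(Torus.geometry d).sepVec ((freeFlight (Torus.geometry d) t z) i).1
          ((freeFlight (Torus.geometry d) t z) j).1‖ + |t| * ‖(z i).2 - (z j).2‖ := by
  have h := Torus.euclidDist_le_euclidDist_translate (z i).1 (z j).1 (t • (z i).2) (t • (z j).2)
  rw [← smul_sub, norm_smul, Real.norm_eq_abs] at h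
  simpa only [freeFlight_apply, Torus.geometry_translate, Torus.norm_geometry_sepVec] using h

/-! ## The pointwise first-collision inclusion -/

/-- **First-collision inclusion, pointwise.**  If a configuration `z` of the hard-sphere domain of the
torus has exit time `τ(z) ≤ δ` (`δ ≥ 0`), then some pair `i ≠ j` starts at minimal-image distance in
`[ε, ε + δ ‖v_i − v_j‖]`: otherwise, by finiteness, every pair is at distance
`> ε + (δ + η) ‖v_i − v_j‖` for some `η > 0`, the free flight stays in the domain on `[0, δ + η)`
(`norm_sepVec_le_norm_sepVec_freeFlight_add`) and `τ(z) ≥ δ + η > δ`. [folklore] -/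
theorem exists_pair_of_freeExitTime_le {d : Type*} [Fintype d] {N : ℕ} {ε δ : ℝ} (hδ : 0 ≤ δ)
    {z : Config N d (UnitAddTorus d)} (hz : z ∈ hardSphereDomain (Torus.geometry d) N ε)
    (hτ : freeExitTime (Torus.geometry d) ε z ≤ ENNReal.ofReal δ) :
    ∃ i j : Fin N, i ≠ j ∧ ε ≤ ‖(Torus.geometry d).sepVec (z i).1 (z j).1‖ ∧
      ‖(Torus.geometry d).sepVec (z i).1 (z j).1‖ ≤ ε + δ * ‖(z i).2 - (z j).2‖ := by
  by_contra hcon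
  push Not at hcon
  -- every pair is strictly outside the shell
  have hstrict : ∀ i j : Fin N, i ≠ j →
      ε + δ * ‖(z i).2 - (z j).2‖ < ‖(Torus.geometry d).sepVec (z i).1 (z j).1‖ :=
    fun i j hij => hcon i j hij (hz i j hij)
  -- a uniform slack `η > 0` over the finitely many pairs
  obtain ⟨η, hη, hslack⟩ : ∃ η : ℝ, 0 < η ∧ ∀ i j : Fin N, i ≠ j →
      ε + (δ + η) * ‖(z i).2 - (z j).2‖ < ‖(Torus.geometry d).sepVec (z i).1 (z j).1‖ := by
    have hev : ∀ᶠ η : ℝ in 𝓝 0, ∀ i j : Fin N, i ≠ j →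
        ε + (δ + η) * ‖(z i).2 - (z j).2‖ < ‖(Torus.geometry d).sepVec (z i).1 (z j).1‖ := by
      refine eventually_all.2 fun i => eventually_all.2 fun j => ?_
      by_cases hij : i = j
      · exact Eventually.of_forall fun _ h => absurd hij h
      have hcont : Tendsto (fun η : ℝ => ε + (δ + η) * ‖(z i).2 - (z j).2‖) (𝓝 0)
          (𝓝 (ε + (δ + 0) * ‖(z i).2 - (z j).2‖)) :=
        (continuous_const.add ((continuous_const.add continuous_id).mul continuous_const)).tendsto 0
      rw [add_zero] at hcont
      exact (hcont.eventually_lt_const (hstrict i j hij)).mono fun η h _ => h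
    obtain ⟨η, hη, hpos⟩ := ((hev.filter_mono nhdsWithin_le_nhds).and
      (self_mem_nhdsWithin : Ioi (0 : ℝ) ∈ 𝓝[>] (0 : ℝ))).exists
    exact ⟨η, hpos, hη⟩
  -- the free flight stays in the domain on `[0, δ + η)`
  have hle : ENNReal.ofReal (δ + η) ≤ freeExitTime (Torus.geometry d) ε z := by
    refine le_freeExitTime_of_forall_mem fun t ht0 htlt => ?_
    have ht : t < δ + η := (ENNReal.ofReal_lt_ofReal_iff (by linarith)).1 htlt
    intro i j hij
    have h1 := norm_sepVec_le_norm_sepVec_freeFlight_add z t i j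
    rw [abs_of_nonneg ht0] at h1
    have h2 := hslack i j hij
    have hg : t * ‖(z i).2 - (z j).2‖ ≤ (δ + η) * ‖(z i).2 - (z j).2‖ :=
      mul_le_mul_of_nonneg_right ht.le (norm_nonneg _)
    linarith
  have h := hle.trans hτ
  rw [ENNReal.ofReal_le_ofReal_iff hδ] at h
  linarith

/-! ## The first-collision inclusion under a law `P ≪ Liouville` -/

/-- **First-collision inclusion (E3).**  For `0 < σ < 1/2`, `N`, a finite law `P ≪ Liouville` on the
phase space of `N + 1` hard spheres of diameter `ε = hsDiameter σ N` in `𝕋³`, and `δ ≥ 0`: if at least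
one Lambertian collision happens in `[0, δ]` then the first collision instant `t_1 = τ(z)` is `≤ δ`
(whatever the noise), and — `P`-almost surely `z` lies in the hard-sphere domain, where every particle
flies freely before `τ(z)` — some pair `(i, j)` starts at minimal-image distance in
`[ε, ε + δ ‖v_i − v_j‖]` (`exists_pair_of_freeExitTime_le`); finite subadditivity over the pairs.
[folklore] -/
theorem measure_lambertCount_pos_le :
    ∀ {σ : ℝ}, 0 < σ → σ < 2⁻¹ → ∀ (N : ℕ) (P : Measure (Config (N + 1) (Fin 3) T3)) [IsFiniteMeasure P],
      P ≪ liouville (Torus.geometry (Fin 3)) (N + 1) (hsDiameter σ N) → ∀ δ : ℝ, 0 ≤ δ →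
        (P.prod (lambertNoise (Fin 3))) {p | 1 ≤ lambertCount (Torus.geometry (Fin 3)) (hsDiameter σ N) p.2 p.1 δ} ≤
          ∑ i : Fin (N + 1), ∑ j : Fin (N + 1),
            P {z | i ≠ j ∧ hsDiameter σ N ≤ ‖(Torus.geometry (Fin 3)).sepVec (z i).1 (z j).1‖ ∧
              ‖(Torus.geometry (Fin 3)).sepVec (z i).1 (z j).1‖ ≤ hsDiameter σ N + δ * ‖(z i).2 - (z j).2‖} := by
  intro σ _hσ _hσ' N P _ hP δ hδ
  set G := Torus.geometry (Fin 3) with hG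
  set ε := hsDiameter σ N with hε
  -- the event `{τ ≤ δ}` of the configuration alone, the domain, and the pair events
  set A : Set (Config (N + 1) (Fin 3) T3) := {z | freeExitTime G ε z ≤ ENNReal.ofReal δ} with hA
  set D : Set (Config (N + 1) (Fin 3) T3) := hardSphereDomain G (N + 1) ε with hD
  set E : Fin (N + 1) → Fin (N + 1) → Set (Config (N + 1) (Fin 3) T3) := fun i j =>
    {z | i ≠ j ∧ ε ≤ ‖G.sepVec (z i).1 (z j).1‖ ∧
      ‖G.sepVec (z i).1 (z j).1‖ ≤ ε + δ * ‖(z i).2 - (z j).2‖} with hE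
  -- Step 1: at least one collision in `[0, δ]` forces `τ(z) ≤ δ`, whatever the noise
  have h1 : {p : Config (N + 1) (Fin 3) T3 × (ℕ → EuclideanSpace ℝ (Fin 3)) |
      1 ≤ lambertCount G ε p.2 p.1 δ} ⊆ A ×ˢ (univ : Set (ℕ → EuclideanSpace ℝ (Fin 3))) := by
    rintro ⟨z, ξs⟩ hp
    refine ⟨?_, mem_univ _⟩
    by_contra hlt
    have h0 : lambertCount G ε ξs z δ = 0 := lambertCount_eq_zero_of_lt (not_le.1 hlt)
    have hp' : 1 ≤ lambertCount G ε ξs z δ := hp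
    omega
  -- Step 2: the product measure of a cylinder
  have h2 : (P.prod (lambertNoise (Fin 3))) (A ×ˢ (univ : Set (ℕ → EuclideanSpace ℝ (Fin 3)))) ≤ P A := by
    refine (Measure.prod_prod_le _ _).trans ?_
    rw [measure_univ, mul_one]
  -- Step 3: `P`-a.e. configuration lies in the domain; pointwise inclusion there
  have hDm : MeasurableSet D := measurableSet_hardSphereDomain _ Torus.measurable_geometry_sepVec _ _
  have hae : ∀ᵐ z ∂P, z ∈ D := hP.ae_le (by rw [liouville_eq]; exact ae_restrict_mem hDm)
  have h3 : P A ≤ P (⋃ i, ⋃ j, E i j) := by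
    refine measure_mono_ae (hae.mono fun z hzD => ?_)
    intro hzA
    obtain ⟨i, j, hij, hlo, hhi⟩ := exists_pair_of_freeExitTime_le hδ hzD hzA
    exact mem_iUnion.2 ⟨i, mem_iUnion.2 ⟨j, hij, hlo, hhi⟩⟩
  -- Step 4: finite subadditivity over the pairs
  calc (P.prod (lambertNoise (Fin 3))) {p | 1 ≤ lambertCount G ε p.2 p.1 δ}
      ≤ (P.prod (lambertNoise (Fin 3))) (A ×ˢ (univ : Set (ℕ → EuclideanSpace ℝ (Fin 3)))) :=
        measure_mono h1
    _ ≤ P A := h2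
    _ ≤ P (⋃ i, ⋃ j, E i j) := h3
    _ ≤ ∑ i, P (⋃ j, E i j) := measure_iUnion_fintype_le P _
    _ ≤ ∑ i, ∑ j, P (E i j) := Finset.sum_le_sum fun i _ => measure_iUnion_fintype_le P (E i)

end Summit.AtomisticToContinuum.HydrodynamicLimit.Theorems.LambertianContactSwapLambertianEulerFirstCollision

end
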